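import Mathlib
import HarnessLib
import Summits.NavierStokesRegularity.FluidComputer.TriggeredTransferLedger
import Summits.NavierStokesRegularity.FluidComputer.TriggeredTransferDataZoom

/-!
# Fluid computer, door N1-FC — the TOLERANCE-ROBUST twin of the one-shot triggered transfer, and its calibration against the exact typing («OneShot ↔ Robust» at the door level)

Cell `ns-blowup`, seat `ns-blowup-fc-prover-2` (D-0074 GROUP C «bridge support»; director's text
«fc-prover-2: OneShot → Robust under the PREREG's detection floor»); companion of
`TriggeredTransfer.lean` (seat `ns-blowup-fc-route`: the door vocabulary `TriggerScheme`, `IsTrigger`,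
`Step`, `Transfers`) and of `TriggeredTransferLedger.lean` (seat `ns-blowup-fc-prover-1`). LABEL: E–C
typing / calibration. WHAT THIS IS NOT: not Navier–Stokes evidence and not a construction — every
theorem below is an implication between OPEN predicates (`TriggerScheme.Transfers`,
`TriggerScheme.TransfersWithin`, never asserted anywhere) or elementary calculus of the zoom map
`x ↦ c • w (c • (x - x₀))`; no instance of any scheme is claimed.

## Why this file exists

`TriggerScheme.Step ν U ε w` (the ONE-SHOT triggered transfer) demands that the hand-over slice be
EXACTLY a `λ`-zoomed member of the designed family: `u T = x ↦ λ • w' (λ • (x - x₀))`, `w' ∈ F U'`.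
What a fluid computer needs, and what a MODEL cell (PREREG-FC-TRIG-1 and -2: one-shot transfer
efficiency read with a detection floor, robustness against trigger-amplitude and noise variations) can
at best witness, is the TOLERANCE-ROBUST statement [cite: Tao2016AveragedNS, §1.3] («gates with good
noise tolerance»): from every state within relative sup-distance `ρin` of the alphabet the fluid
performs one triggered transfer whose hand-over slice is within relative sup-distance `ρout` of a zoomed
alphabet member. This file types that twin and proves that the exact typing is NOT a strengthening:

* (companion file `TriggeredTransferDataZoom.lean`, imported) `zoom c x₀ w = (x ↦ c • w (c • (x - x₀)))`,
  `unzoom` (its inverse for `c ≠ 0`), and the transport of the three Clay clauses (4) through the zoom: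
  `contDiff_zoom`, `isDivFree_zoom`, `hasRapidSpatialDecay_zoom`;
* `TriggerScheme.nbhd ρ U` — the Clay-class relative-sup `ρ·U`-neighbourhood of `F U`;
  `TriggerScheme.StepWithin ν U ε w ρ` — one triggered transfer with hand-over tolerance `ρ·(λU')`
  (the slice's rapid decay, IMPLICIT in the exact typing through `clay`, is an EXPLICIT conjunct here);
  `TriggerScheme.TransfersWithin ν ρin ρout` — the robust step from the whole `ρin`-neighbourhood
  (the door seat's «K_T1 UnitTransfer with tolerances», STATUS l.2095 (2));
* `TriggerScheme.fatten ρ` — the scheme whose alphabet is the `ρ`-neighbourhood of the old one (speed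
  floor `c - ρ`, so `ρ < c`), and the seam
  `TriggerScheme.transfers_fatten : 0 ≤ ρout → ρout ≤ ρin → ρin < c → TransfersWithin ν ρin ρout →
  (fatten ρin).Transfers ν` — once the output tolerance does not exceed the input tolerance («the
  rescaled output is again in the alphabet with the SAME tolerances», K_T2, is then AUTOMATIC: Tao's
  no-accumulation-of-errors, Prop. 6.4 of the averaged paper, in sup-norm clothing), a tolerance-robust
  scheme IS an exact scheme on the fattened alphabet;
* the trivial converse `transfersWithin_of_transfers : Transfers ν → TransfersWithin ν 0 0` and the
  calibration `exists_transfers_iff_exists_transfersWithin`: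
  `(∃ 𝒮, 𝒮.Transfers ν) ↔ (∃ 𝒮 ρin ρout, 0 ≤ ρout ≤ ρin < 𝒮.c ∧ 𝒮.TransfersWithin ν ρin ρout)`.

Why the SUP norm (relative to the amplitude) and not the energy norm of `RobustGadgetLibrary.rho`: the
scheme's only readout is the pointwise speed floor `c·U` in the nest ball (`TriggerScheme.floor`), and an
`L²`-small kick deletes a pointwise floor (a tiny-volume modification) — the same reason the N1 line
`fc-oneshot` types its `RescaledCopy` with a sup-error `δ·Y_k`. Energy tolerances and the detection-floor
arithmetic of the PREREG (reading `η_r`, floor `δ`: certified `η ≥ η_r - δ`) are in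
`GadgetDetectionFloor.lean`; they enter a scheme only through the static constant `eta`.

0 sorry; axioms ⊆ {propext, Classical.choice, Quot.sound}. References: T. Tao, J. Amer. Math. Soc. 29
(2016) §1.3 and Prop. 6.4 [cite: Tao2016AveragedNS, §1.3]; C. L. Fefferman, Clay problem description,
(4) [cite: FeffermanClay2006, (A) (4)].
-/

noncomputable section

namespace Summit.NavierStokesRegularity.FluidComputer.TriggeredTransfer

open Set MeasureTheory Function Module
open scoped ENNReal ContDiff NNReal
open Literature.Analysis.FluidPDE
open Literature.Analysis.FluidPDE.FluidComputer (E3 Vel)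

namespace TriggerScheme

variable (𝒮 : TriggerScheme)

/-! ## The tolerance-robust twin -/

/-- **The `ρ`-neighbourhood of the alphabet at amplitude `U`**: Clay data (smooth, divergence free,
rapidly decaying — (A)(4)) within RELATIVE SUP-distance `ρ·U` of some member of `F U`. [folklore] -/
def nbhd (ρ U : ℝ) : Set Vel :=
  {v | (ContDiff ℝ ∞ v ∧ NSWave0.IsDivFree v ∧ HasRapidSpatialDecay v) ∧
    ∃ w ∈ 𝒮.F U, ∀ x, ‖v x - w x‖ ≤ ρ * U}

/-- **One triggered transfer with hand-over tolerance `ρ`** at viscosity `ν`, from `w` at amplitude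
`U`, trigger amplitude `ε`: as `TriggerScheme.Step` (hand-over time `T ≤ C_τ (1 + |log ε|)^q / U`,
margin `δ`, admissible trigger `g`, an exact classical solution on `[0, T + δ]` from `w` with finite
energy) except that the hand-over slice `u T` is only required to be within relative sup-distance
`ρ · (λ U')` of the `λ`-zoom of a member `w' ∈ F U'`, `U' ≥ (ηλ)^{1/2} U`, `‖x₀‖ ≤ D`; the slice's
rapid decay (4) — implicit in the exact typing, where `u T` IS a zoomed Clay member — is an explicit
conjunct. `ρ = 0` with a member recovers `Step` (`step_of_stepWithin_zero`-direction inside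
`transfers_fatten`). [cite: Tao2016AveragedNS, §1.3] -/
def StepWithin (ν U ε : ℝ) (w : Vel) (ρ : ℝ) : Prop :=
  ∃ (T δ : ℝ) (g : ℝ → Vel) (u : ℝ → Vel) (p : ℝ → E3 → ℝ),
    0 < δ ∧ 2 * δ < T ∧ T ≤ 𝒮.Cτ * (1 + |Real.log ε|) ^ 𝒮.q / U ∧
    𝒮.IsTrigger ε δ T g ∧
    IsClassicalNSSolutionOn (Icc 0 (T + δ)) ν g u p ∧ u 0 = w ∧
    (∃ C : ℝ≥0∞, C < ⊤ ∧ ∀ t ∈ Icc 0 (T + δ), ∫⁻ x, ‖u t x‖ₑ ^ 2 ≤ C) ∧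
    HasRapidSpatialDecay (u T) ∧
    ∃ (U' : ℝ) (w' : Vel) (x₀ : E3), 𝒮.growth * U ≤ U' ∧ w' ∈ 𝒮.F U' ∧ ‖x₀‖ ≤ 𝒮.D ∧
      ∀ x, ‖u T x - zoom 𝒮.lam x₀ w' x‖ ≤ ρ * (𝒮.lam * U')

/-- **The scheme transfers ROBUSTLY at viscosity `ν`, tolerances `(ρin, ρout)`** («K_T1, unit transfer
with tolerances»): from EVERY Clay-class state within relative sup-distance `ρin·U` of the alphabet at
EVERY amplitude `U ≥ U⋆`, for EVERY admissible trigger amplitude (`0 < ε ≤ 1`, `ν |log ε| ≤ a U`), one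
triggered transfer with hand-over tolerance `ρout` is available. The tolerance-robust twin of
`TriggerScheme.Transfers`; the noise tolerance asked of fluid gates in [cite: Tao2016AveragedNS, §1.3].
Open; never asserted in the tree. -/
def TransfersWithin (ν ρin ρout : ℝ) : Prop :=
  ∀ U, 𝒮.UStar ≤ U → ∀ v ∈ 𝒮.nbhd ρin U, ∀ ε : ℝ, 0 < ε → ε ≤ 1 → ν * |Real.log ε| ≤ 𝒮.a * U →
    𝒮.StepWithin ν U ε v ρout

variable {𝒮}

/-- Members of the alphabet (at amplitudes `≥ U⋆`) lie in every nonnegative neighbourhood of it.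
[folklore] -/
theorem mem_nbhd_of_mem {ρ U : ℝ} (hρ : 0 ≤ ρ) (hU : 𝒮.UStar ≤ U) {w : Vel} (hw : w ∈ 𝒮.F U) :
    w ∈ 𝒮.nbhd ρ U := by
  refine ⟨𝒮.clay U hU w hw, w, hw, fun x => ?_⟩
  rw [sub_self, norm_zero]
  exact mul_nonneg hρ (𝒮.UStar_pos.le.trans hU)

/-- The `0`-neighbourhood of the alphabet is the alphabet (at amplitudes `≥ U⋆`). [folklore] -/
theorem nbhd_zero {U : ℝ} (hU : 𝒮.UStar ≤ U) : 𝒮.nbhd 0 U = 𝒮.F U := by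
  ext v
  constructor
  · rintro ⟨-, w, hw, hvw⟩
    have : v = w := funext fun x => by
      have h := hvw x
      rw [zero_mul] at h
      exact sub_eq_zero.1 (norm_le_zero_iff.1 h)
    rw [this]
    exact hw
  · exact mem_nbhd_of_mem le_rfl hU

/-- Neighbourhoods are monotone in the tolerance (for `U ≥ 0`). [folklore] -/
theorem nbhd_mono {ρ ρ' U : ℝ} (h : ρ ≤ ρ') (hU : 0 ≤ U) : 𝒮.nbhd ρ U ⊆ 𝒮.nbhd ρ' U := by
  rintro v ⟨hclay, w, hw, hvw⟩
  exact ⟨hclay, w, hw, fun x => (hvw x).trans (mul_le_mul_of_nonneg_right h hU)⟩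

/-- The hand-over tolerance can be relaxed (amplitudes `U ≥ 0`). [folklore] -/
theorem StepWithin.mono {ν U ε ρ ρ' : ℝ} {w : Vel} (h : 𝒮.StepWithin ν U ε w ρ) (hρ : ρ ≤ ρ')
    (hU : 0 ≤ U) : 𝒮.StepWithin ν U ε w ρ' := by
  obtain ⟨T, δ, g, u, p, hδ, h2δ, hT, hg, hsol, hu0, hE, hdec, U', w', x₀, hgrow, hw', hx₀, hclose⟩ :=
    h
  have hU' : 0 ≤ U' := le_trans (mul_nonneg 𝒮.growth_pos.le hU) hgrow
  refine ⟨T, δ, g, u, p, hδ, h2δ, hT, hg, hsol, hu0, hE, hdec, U', w', x₀, hgrow, hw', hx₀,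
    fun x => (hclose x).trans ?_⟩
  exact mul_le_mul_of_nonneg_right hρ (mul_nonneg 𝒮.lam_pos.le hU')

/-- Robust transfer is antitone in the input tolerance and monotone in the output tolerance.
[folklore] -/
theorem TransfersWithin.mono {ν ρin ρin' ρout ρout' : ℝ} (h : 𝒮.TransfersWithin ν ρin ρout)
    (hin : ρin' ≤ ρin) (hout : ρout ≤ ρout') : 𝒮.TransfersWithin ν ρin' ρout' := by
  intro U hU v hv ε hε hε1 hadm
  have hU0 : 0 ≤ U := 𝒮.UStar_pos.le.trans hU
  exact (h U hU v (nbhd_mono hin hU0 hv) ε hε hε1 hadm).mono hout hU0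

/-! ## The exact typing is the tolerance-`0` case -/

/-- An exact step from a member is a step with hand-over tolerance `0` (the hand-over slice IS the
zoom of a Clay member, hence rapidly decaying by `hasRapidSpatialDecay_zoom`). Needs `U ≥ 0` so that
the target amplitude `U' ≥ (ηλ)^{1/2} U` is above threshold whenever `U` is. [folklore] -/
theorem stepWithin_zero_of_step {ν U ε : ℝ} {w : Vel} (hU : 𝒮.UStar ≤ U) (h : 𝒮.Step ν U ε w) :
    𝒮.StepWithin ν U ε w 0 := by
  obtain ⟨T, δ, g, u, p, hδ, h2δ, hT, hg, hsol, hu0, hE, U', w', x₀, hgrow, hw', hx₀, hslice⟩ := h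
  have hU0 : 0 ≤ U := 𝒮.UStar_pos.le.trans hU
  have hU' : 𝒮.UStar ≤ U' :=
    hU.trans (le_trans (le_mul_of_one_le_left hU0 𝒮.one_lt_growth.le) hgrow)
  have hclay := 𝒮.clay U' hU' w' hw'
  have hzoom : u T = zoom 𝒮.lam x₀ w' := by rw [hslice]; rfl
  refine ⟨T, δ, g, u, p, hδ, h2δ, hT, hg, hsol, hu0, hE, ?_, U', w', x₀, hgrow, hw', hx₀, fun x => ?_⟩
  · rw [hzoom]
    exact hasRapidSpatialDecay_zoom hclay.1 hclay.2.2 𝒮.lam_pos x₀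
  · rw [hzoom, sub_self, norm_zero, zero_mul]

/-- **OneShot ⇒ Robust (tolerance `0`)**: an exactly transferring scheme transfers robustly with
tolerances `(0, 0)` (its `0`-neighbourhoods are its alphabet). [folklore] -/
theorem transfersWithin_of_transfers {ν : ℝ} (h : 𝒮.Transfers ν) : 𝒮.TransfersWithin ν 0 0 := by
  intro U hU v hv ε hε hε1 hadm
  rw [nbhd_zero hU] at hv
  exact stepWithin_zero_of_step hU (h U hU v hv ε hε hε1 hadm)

/-! ## Fattening the alphabet: Robust ⇒ OneShot on the `ρ`-neighbourhood -/

variable (𝒮)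

/-- **The fattened scheme**: same constants and laws, alphabet `F U ↦ nbhd ρ U` (the Clay-class
relative-sup `ρ·U`-neighbourhood), speed floor `c ↦ c - ρ` (a `ρ·U`-sup-perturbation of a state with
speed `≥ c U` somewhere has speed `≥ (c - ρ) U` there), so `0 ≤ ρ < c` is required; the ignition
member of `𝒮` ignites `𝒮.fatten ρ`. [folklore] -/
def fatten (ρ : ℝ) (hρ : 0 ≤ ρ) (hρc : ρ < 𝒮.c) : TriggerScheme where
  lam := 𝒮.lam
  eta := 𝒮.eta
  UStar := 𝒮.UStar
  F := fun U => 𝒮.nbhd ρ U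
  R := 𝒮.R
  c := 𝒮.c - ρ
  D := 𝒮.D
  A := 𝒮.A
  a := 𝒮.a
  Cτ := 𝒮.Cτ
  q := 𝒮.q
  one_lt_lam := 𝒮.one_lt_lam
  kelvin := 𝒮.kelvin
  eta_le_one := 𝒮.eta_le_one
  UStar_pos := 𝒮.UStar_pos
  R_pos := 𝒮.R_pos
  c_pos := sub_pos.2 hρc
  D_nonneg := 𝒮.D_nonneg
  A_nonneg := 𝒮.A_nonneg
  a_pos := 𝒮.a_pos
  Cτ_pos := 𝒮.Cτ_pos
  clay := fun _ _ _ hv => hv.1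
  floor := by
    intro U hU v hv
    obtain ⟨-, w, hw, hvw⟩ := hv
    obtain ⟨x, hxR, hfloor⟩ := 𝒮.floor U hU w hw
    refine ⟨x, hxR, ?_⟩
    have h1 : ‖w x‖ - ‖v x - w x‖ ≤ ‖v x‖ := by
      have := norm_sub_norm_le (w x) (w x - v x)
      rw [sub_sub_cancel, norm_sub_rev] at this
      linarith
    have h2 := hvw x
    nlinarith [h1, h2, hfloor]
  seed := by
    obtain ⟨U, hU, w, hw⟩ := 𝒮.seed
    exact ⟨U, hU, w, mem_nbhd_of_mem hρ hU hw⟩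

variable {𝒮}

/-- The fattened scheme has the same growth factor `(ηλ)^{1/2}`. [folklore] -/
@[simp] theorem growth_fatten {ρ : ℝ} (hρ : 0 ≤ ρ) (hρc : ρ < 𝒮.c) :
    (𝒮.fatten ρ hρ hρc).growth = 𝒮.growth := rfl

/-- The alphabet of the fattened scheme is the `ρ`-neighbourhood of the old one. [folklore] -/
@[simp] theorem F_fatten {ρ : ℝ} (hρ : 0 ≤ ρ) (hρc : ρ < 𝒮.c) (U : ℝ) :
    (𝒮.fatten ρ hρ hρc).F U = 𝒮.nbhd ρ U := rfl

/-- Triggers of `𝒮` are triggers of the fattened scheme (same nest radius, same shape constants).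
[folklore] -/
theorem isTrigger_fatten {ρ : ℝ} (hρ : 0 ≤ ρ) (hρc : ρ < 𝒮.c) {ε δ T : ℝ} {g : ℝ → Vel}
    (hg : 𝒮.IsTrigger ε δ T g) : (𝒮.fatten ρ hρ hρc).IsTrigger ε δ T g :=
  ⟨hg.smooth, hg.off_early, hg.off_late, hg.off_far, hg.small⟩

/-- **The unzoomed hand-over slice of a tolerant step is in the neighbourhood of the alphabet.**
If `u T` (smooth, divergence free, rapidly decaying) is within sup-distance `ρout · (λ U')` of
`zoom λ x₀ w'`, `w' ∈ F U'`, `U' ≥ 0`, `ρout ≤ ρin`, then `unzoom λ x₀ (u T) ∈ nbhd ρin U'` — and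
`u T` is EXACTLY its `λ`-zoom (`zoom_unzoom`). [folklore] -/
theorem unzoom_mem_nbhd {ρin ρout U' : ℝ} {s w' : Vel} {x₀ : E3} (hio : ρout ≤ ρin) (hU' : 0 ≤ U')
    (hs : ContDiff ℝ ∞ s ∧ NSWave0.IsDivFree s ∧ HasRapidSpatialDecay s) (hw' : w' ∈ 𝒮.F U')
    (hclose : ∀ x, ‖s x - zoom 𝒮.lam x₀ w' x‖ ≤ ρout * (𝒮.lam * U')) :
    unzoom 𝒮.lam x₀ s ∈ 𝒮.nbhd ρin U' := by
  have hl := 𝒮.lam_pos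
  refine ⟨?_, w', hw', fun y => ?_⟩
  · rw [unzoom_eq_zoom hl.ne']
    exact clay_zoom hs (inv_pos.2 hl) _
  · have hclose' : ∀ x, ‖s x - zoom 𝒮.lam x₀ w' x‖ ≤ ρout * U' * 𝒮.lam := fun x => by
      rw [mul_assoc, mul_comm U']; exact hclose x
    exact (norm_unzoom_sub_le hl hclose' y).trans (mul_le_mul_of_nonneg_right hio hU')

/-- **Robust ⇒ OneShot («K_T1 + K_T2 ⇒ Transfers»).** If `𝒮` transfers robustly with tolerances
`0 ≤ ρout ≤ ρin < c`, then the fattened scheme `𝒮.fatten ρin` transfers EXACTLY: from every member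
`v` of the `ρin`-neighbourhood the robust step runs; its hand-over slice `u T`, within `ρout · λU'` of
a zoomed member, is EXACTLY the `λ`-zoom of `unzoom λ x₀ (u T)`, which is a Clay state within
`ρout·U' ≤ ρin·U'` of the alphabet, i.e. a member of the fattened alphabet at amplitude `U'` — the
alphabet closure «output again in the alphabet with the SAME tolerances» is automatic once
`ρout ≤ ρin` (no accumulation of errors; the sup-norm form of [cite: Tao2016AveragedNS, Prop. 6.4]).
HONEST FRAMING: an implication between open predicates; no scheme is claimed to transfer. -/
theorem transfers_fatten {ν ρin ρout : ℝ} (h0 : 0 ≤ ρout) (hio : ρout ≤ ρin) (hρc : ρin < 𝒮.c)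
    (hT : 𝒮.TransfersWithin ν ρin ρout) : (𝒮.fatten ρin (h0.trans hio) hρc).Transfers ν := by
  intro U hU v hv ε hε hε1 hadm
  have hU0 : 0 ≤ U := 𝒮.UStar_pos.le.trans hU
  obtain ⟨T, δ, g, u, p, hδ, h2δ, hTlaw, hg, hsol, hu0, hE, hdec, U', w', x₀, hgrow, hw', hx₀,
    hclose⟩ := hT U hU v hv ε hε hε1 hadm
  have hU' : 0 ≤ U' := le_trans (mul_nonneg 𝒮.growth_pos.le hU0) hgrow
  have hTmem : T ∈ Icc 0 (T + δ) := ⟨by linarith, by linarith⟩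
  have hsT : ContDiff ℝ ∞ (u T) := hsol.contDiff_velocity hTmem
  have hdivT : NSWave0.IsDivFree (u T) := hsol.divFree T hTmem
  have hmem : unzoom 𝒮.lam x₀ (u T) ∈ 𝒮.nbhd ρin U' :=
    unzoom_mem_nbhd hio hU' ⟨hsT, hdivT, hdec⟩ hw' hclose
  refine ⟨T, δ, g, u, p, hδ, h2δ, hTlaw, isTrigger_fatten _ _ hg, hsol, hu0, hE, U',
    unzoom 𝒮.lam x₀ (u T), x₀, hgrow, hmem, hx₀, ?_⟩
  exact (zoom_unzoom 𝒮.lam_pos.ne' x₀ (u T)).symm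


/-! ## The affine error budget (spec-sheet keys `amp`, `leak` in sup-norm units) -/

variable (𝒮)

/-- **Robust transfer with an AFFINE ERROR BUDGET**: for every input tolerance `0 ≤ ρ < c` the
scheme transfers robustly with output tolerance `amp · ρ + leak` — noise amplification `amp` and
leakage `leak` per gate, the keys of SPEC-SHEET §2 (C) (`GadgetSpec.amp`, `GadgetSpec.leak`) read in
relative sup-norm units; what a perturbation-pair protocol of a MODEL cell estimates. Open; never
asserted. [cite: Tao2016AveragedNS, §1.3] -/
def TransfersWithBudget (ν amp leak : ℝ) : Prop :=
  ∀ ρ, 0 ≤ ρ → ρ < 𝒮.c → 𝒮.TransfersWithin ν ρ (amp * ρ + leak)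

variable {𝒮}

/-- **Closure of the budget ⇒ exact transfer on the fattened alphabet.** If the affine error budget
closes at a tolerance below the floor constant — `amp · ρ + leak ≤ ρ < c` (the sup-norm twin of
`GadgetSpec.Closure`: `amp · radius + leak ≤ eta · radius`) — then `𝒮.fatten ρ` transfers exactly.
[folklore] -/
theorem transfers_of_budget {ν amp leak ρ : ℝ} (hamp : 0 ≤ amp) (hleak : 0 ≤ leak) (hρ0 : 0 ≤ ρ)
    (hρc : ρ < 𝒮.c) (hclos : amp * ρ + leak ≤ ρ) (h : 𝒮.TransfersWithBudget ν amp leak) :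
    (𝒮.fatten ρ hρ0 hρc).Transfers ν :=
  transfers_fatten (by positivity) hclos hρc (h ρ hρ0 hρc)

/-- **When does the budget close below the floor?** For `amp < 1` the affine map `ρ ↦ amp·ρ + leak`
has the fixed point `leak / (1 - amp)`; a closing tolerance `ρ < c` exists iff that fixed point is
`< c` — «how small the leakage must be, as a function of the amplification and the speed floor».
[folklore] -/
theorem exists_closing_tolerance_iff {amp leak : ℝ} (hamp : amp < 1) (hleak : 0 ≤ leak) :
    (∃ ρ, 0 ≤ ρ ∧ ρ < 𝒮.c ∧ amp * ρ + leak ≤ ρ) ↔ leak / (1 - amp) < 𝒮.c := by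
  have h1 : 0 < 1 - amp := sub_pos.2 hamp
  constructor
  · rintro ⟨ρ, -, hρc, hclos⟩
    have hfix : leak / (1 - amp) ≤ ρ := by
      rw [div_le_iff₀ h1]
      nlinarith
    exact lt_of_le_of_lt hfix hρc
  · intro h
    refine ⟨leak / (1 - amp), div_nonneg hleak h1.le, h, ?_⟩
    have : amp * (leak / (1 - amp)) + leak = leak / (1 - amp) := by
      field_simp
      ring
    rw [this]

/-- **The calibration («OneShot ↔ Robust» at the door level).** At every viscosity: an EXACTLY
transferring one-shot triggered-transfer scheme exists iff a TOLERANCE-ROBUSTLY transferring one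
exists (tolerances `0 ≤ ρout ≤ ρin < c`). The exact hand-over typing of `TriggerScheme.Step` is
therefore not a strengthening of the door's crux over its tolerance-robust (DNS-measurable) form; the
content a MODEL witness must supply is `TransfersWithin` with `ρout ≤ ρin`. HONEST FRAMING: both sides
are open; nothing is asserted. [folklore] -/
theorem exists_transfers_iff_exists_transfersWithin (ν : ℝ) :
    (∃ 𝒮 : TriggerScheme, 𝒮.Transfers ν) ↔
      ∃ (𝒮 : TriggerScheme) (ρin ρout : ℝ),
        0 ≤ ρout ∧ ρout ≤ ρin ∧ ρin < 𝒮.c ∧ 𝒮.TransfersWithin ν ρin ρout := by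
  constructor
  · rintro ⟨𝒮, h⟩
    exact ⟨𝒮, 0, 0, le_rfl, le_rfl, 𝒮.c_pos, transfersWithin_of_transfers h⟩
  · rintro ⟨𝒮, ρin, ρout, h0, hio, hρc, h⟩
    exact ⟨𝒮.fatten ρin (h0.trans hio) hρc, transfers_fatten h0 hio hρc h⟩

end TriggerScheme

end Summit.NavierStokesRegularity.FluidComputer.TriggeredTransfer

end
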